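import Literature.NumberTheory.DiophantineApproximation.PrimeFractionalPartClasses
import HarnessLib

/-!
# Primes `p` with `{n/p} ∈ [u, v)` and `p² > Cn`: the cut-off of the permutation group method

Topic `Literature/NumberTheory/DiophantineApproximation`; continues `PrimeFractionalPartClasses.lean`
(everything PROVED, no definitions, no named facts). In `Δ_n = ∏_{p > √(Hn), {n/p} ∈ Ω} p`
(Rhin–Viola; Viola–Zudilin 2018, §6.1) only the primes `p > √(Hn)` (one Legendre digit) are used; the
primes `p ≤ √(Hn)` weigh `θ(√(Hn)) ≤ log 4 · √(Hn) = o(n)`, so the density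
`(1/n) ∑ log p → ∑_k (1/(k+u) − 1/(k+v))` of `RhinViola.tendsto_sum_log_prime_fract_div` is unchanged by
the cut-off (`tendsto_sum_log_prime_fract_div_cutoff`). For a finite disjoint union `Ω` of intervals, add.

## References

* C. Viola, W. Zudilin, *Linear independence of dilogarithmic values*, J. reine angew. Math. 736 (2018),
  §6.1 (`Δ_n`, `c₃`). [ViolaZudilin2018]
-/

noncomputable section

namespace Literature.NumberTheory.DiophantineApproximation

namespace RhinViola

open _root_.Filter _root_.Topology Finset

/-! ### The cut-off `p² > Cn` of the method -/

/-- The primes below `√x` weigh `θ(√x) ≤ log 4 · √x = o(x)`: for `C ≥ 0` and every `ε > 0`, eventually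
`log 4 · √(C n) < ε n`. [folklore] -/
theorem eventually_log_four_mul_sqrt_lt {C : ℝ} (hC : 0 ≤ C) {ε : ℝ} (hε : 0 < ε) :
    ∀ᶠ n : ℕ in atTop, Real.log 4 * Real.sqrt (C * n) < ε * n := by
  have hlog4 : 0 < Real.log 4 := Real.log_pos (by norm_num)
  obtain ⟨N₀, hN₀⟩ := exists_nat_gt (Real.log 4 ^ 2 * C / ε ^ 2)
  filter_upwards [eventually_ge_atTop (max N₀ 1)] with n hn
  have hn1 : (1 : ℝ) ≤ n := by exact_mod_cast le_trans (le_max_right _ _) hn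
  have hnN : (N₀ : ℝ) ≤ n := by exact_mod_cast le_trans (le_max_left _ _) hn
  have hn0 : (0 : ℝ) < n := by linarith
  refine lt_of_pow_lt_pow_left₀ 2 (by positivity) ?_
  rw [mul_pow, Real.sq_sqrt (by positivity), mul_pow]
  have h1 : Real.log 4 ^ 2 * C < ε ^ 2 * n := by
    rw [div_lt_iff₀ (by positivity)] at hN₀
    nlinarith
  nlinarith

/-- The primes removed by the cut-off `p² > Cn` contribute at most `θ(√(Cn)) ≤ log 4 · √(Cn)` to any sum of
`log p` over a set of primes. [folklore] -/
theorem sum_log_le_of_sq_le (C : ℝ) (n : ℕ) (s : Finset ℕ)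
    (hs : ∀ p ∈ s, p.Prime ∧ ((p : ℝ)) ^ 2 ≤ C * n) :
    ∑ p ∈ s, Real.log p ≤ Real.log 4 * Real.sqrt (C * n) := by
  have hsub : s ⊆ (Ioc 0 ⌊Real.sqrt (C * n)⌋₊).filter Nat.Prime := by
    intro p hp
    obtain ⟨hpr, hsq⟩ := hs p hp
    simp only [mem_filter, mem_Ioc]
    refine ⟨⟨hpr.pos, ?_⟩, hpr⟩
    rw [Nat.le_floor_iff (Real.sqrt_nonneg _)]
    rw [← Real.sqrt_sq (Nat.cast_nonneg p)]
    exact Real.sqrt_le_sqrt hsq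
  calc ∑ p ∈ s, Real.log p ≤ ∑ p ∈ (Ioc 0 ⌊Real.sqrt (C * n)⌋₊).filter Nat.Prime, Real.log p := by
        refine sum_le_sum_of_subset_of_nonneg hsub fun p hp _ => ?_
        exact Real.log_nonneg (by exact_mod_cast (mem_filter.1 hp).2.one_lt.le)
    _ = Chebyshev.theta (Real.sqrt (C * n)) := rfl
    _ ≤ Real.log 4 * Real.sqrt (C * n) := Chebyshev.theta_le_log4_mul_x (Real.sqrt_nonneg _)

/-- **Density of the primes `p` with `p² > Cn` and `u ≤ {n/p} < v`** — the form with the cut-off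
`p > √(Hn)` of the permutation group method (`Δ_n = ∏_{p > √(Hn), {n/p} ∈ Ω} p`): the cut-off removes
`O(√n)` from the sum, so the limit of `tendsto_sum_log_prime_fract_div` is unchanged. For a finite disjoint
union `Ω` of such intervals add the limits. [cite: ViolaZudilin2018, §6.1 (Δ_n and c₃)] -/
theorem tendsto_sum_log_prime_fract_div_cutoff {u v : ℝ} (hu : 0 < u) (huv : u < v) (hv : v ≤ 1)
    (N : ℕ → ℕ) (hN : ∀ n : ℕ, (n : ℝ) / u ≤ N n) {C : ℝ} (hC : 0 ≤ C) :
    Tendsto (fun n : ℕ => (∑ p ∈ (range (N n + 1)).filter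
          (fun p : ℕ => p.Prime ∧ C * n < ((p : ℝ)) ^ 2 ∧
            u ≤ Int.fract ((n : ℝ) / p) ∧ Int.fract ((n : ℝ) / p) < v),
        Real.log p) / n)
      atTop (𝓝 (∑' k : ℕ, (1 / ((k : ℝ) + u) - 1 / ((k : ℝ) + v)))) := by
  set S := ∑' k : ℕ, (1 / ((k : ℝ) + u) - 1 / ((k : ℝ) + v)) with hS
  -- full sum = cut sum + removed sum
  set A : ℕ → Finset ℕ := fun n => (range (N n + 1)).filter
    (fun p : ℕ => p.Prime ∧ u ≤ Int.fract ((n : ℝ) / p) ∧ Int.fract ((n : ℝ) / p) < v) with hA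
  set cut : ℕ → ℝ := fun n => ∑ p ∈ (A n).filter (fun p : ℕ => C * n < ((p : ℝ)) ^ 2), Real.log p
    with hcut
  set rest : ℕ → ℝ := fun n => ∑ p ∈ (A n).filter (fun p : ℕ => ¬ C * n < ((p : ℝ)) ^ 2), Real.log p
    with hrest
  have hsplit : ∀ n, cut n + rest n = ∑ p ∈ A n, Real.log p := fun n =>
    sum_filter_add_sum_filter_not _ _ _
  have hfull := tendsto_sum_log_prime_fract_div hu huv hv N hN
  -- the removed part is `o(n)`
  have hrest0 : ∀ n, 0 ≤ rest n := fun n =>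
    sum_nonneg fun p hp => Real.log_nonneg (by
      have := (mem_filter.1 (mem_filter.1 hp).1).2.1
      exact_mod_cast this.one_lt.le)
  have hrestle : ∀ n : ℕ, rest n ≤ Real.log 4 * Real.sqrt (C * n) := fun n =>
    sum_log_le_of_sq_le C n _ fun p hp => by
      have h1 := mem_filter.1 hp
      exact ⟨(mem_filter.1 h1.1).2.1, not_lt.1 h1.2⟩
  have hrest : Tendsto (fun n : ℕ => rest n / n) atTop (𝓝 0) := by
    rw [Metric.tendsto_nhds]
    intro ε hε
    filter_upwards [eventually_log_four_mul_sqrt_lt hC hε, eventually_ge_atTop 1] with n hn hn1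
    have hn0 : (0 : ℝ) < n := by exact_mod_cast hn1
    rw [Real.dist_0_eq_abs, abs_of_nonneg (div_nonneg (hrest0 n) hn0.le), div_lt_iff₀ hn0]
    exact (hrestle n).trans_lt hn
  have h := hfull.sub hrest
  rw [sub_zero] at h
  refine h.congr' ?_
  filter_upwards [eventually_ge_atTop 1] with n hn1
  -- `(full − rest)/n = cut/n`, and `cut` is the sum in the statement (filters merged)
  have e1 : (∑ p ∈ A n, Real.log p) / n - rest n / n = cut n / n := by
    rw [← hsplit n]; ring
  rw [e1]
  simp only [hcut, hA, Finset.filter_filter]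
  congr 2
  ext p
  simp only [mem_filter]
  tauto

end RhinViola

end Literature.NumberTheory.DiophantineApproximation

end
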